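import Summits.RiemannHypothesis.RiemannHypothesis.Theorems.PfPersistenceM2EvenSectorDivision
import Summits.RiemannHypothesis.RiemannHypothesis.Theorems.PfPersistenceTwoParityIndexOddLower
import Summits.RiemannHypothesis.RiemannHypothesis.Theorems.GroundBartaPolarPerronFrobeniusTruncatedSpreadTests
import HarnessLib

/-!
# PF-persistence, M2 seat (gen 6), part 6b: the annihilation hypothesis (QA_θ) is EQUIVALENT to the classical
# MULTIPLIER statement — `𝒵_θ` lies in the zero set of the transform of ONE non-zero even real test

pub-rhpf cell, M2 seat, generation 6.  HONEST FRAMING (page 1 of everything in this cell): a long-odds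
MECHANISM SEARCH around Weil's quadratic functional; NOTHING here claims, approaches or conditionally proves RH.
Labels: PROVED = kernel-checked; CITED = in print; HYPOTHESIS = an explicit binder; DERIVED = paper level, NOT
kernel-checked.  Notation as in parts 4–5 (`𝒵_θ`, (QA_θ) = `QuadrantAnnihilable θ`).

WHAT THIS PART DOES.  Part 4 typed the `K = ∞` residue of the even level-sign hierarchy as (QA_θ): every
`e ∈ 𝒵_θ` is separated from `𝒵_θ ∖ {e}` by an even real compactly supported test with the value `i` at `e`.  Here
(PROVED, RH-free) that residue is identified with the classical one-function statement

  (MULT_θ) `QuadrantMultiplier θ`: if `𝒵_θ ≠ ∅` there is ONE even, real-valued Weil test `φ` supported in some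
  `[-b, b]` whose transform `φ̂` is not identically zero and vanishes at EVERY point of `𝒵_θ`

— i.e. "`𝒵_θ` is contained in the zero set of the Fourier–Laplace transform of a non-zero smooth even real
function of compact support" (the hypothesis shape of the Paley–Wiener / Beurling–Malliavin multiplier theory).
* `quadrantAnnihilable_iff_multiplier` — (QA_θ) ⟺ (MULT_θ) for `θ > 0`.
  (⇐) DIVISION (part 6a: `exists_divide_of_weilMellin_eq_zero`, `exists_evenReal_divide_quad` — a zero of `f̂`
  is divided out inside the same support interval, a whole quadruple keeping even/real); here: `P_e` has a
  SIMPLE zero at `e` (`analyticOrderAt_quadPoly`), so induction on the (finite) order of vanishing of `f̂` at `e`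
  (Mathlib `analyticOrderAt`) produces a test with `φ̂(e) ≠ 0` still vanishing on `𝒵_θ ∖ {e}`; part 5's phase
  lemma gives the value `i`.  (⇒) multiply the zero back in: `ψ = φ⁗ - 2Re(λ²) φ″ + |λ²|² φ`, `λ = e - ½`, has
  `ψ̂ = P_e · φ̂` with `P_e(s) = (s-e)(s-ē)(s-1+e)(s-1+ē)`.
* `QuadrantMultiplier.mono` — monotone in `θ`; so the residue of parts 3–5 reads: "for every `θ > 0` with
  `𝒵_θ ≠ ∅`, some non-zero even real test has transform vanishing on `𝒵_θ`".
STATUS of (MULT_θ) for infinite `𝒵_θ`: DERIVED exactly as in part 5's module docstring (Carlson density ⇒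
exponent `< 1` ⇒ canonical product `F` of order `< 1` ⇒ `φ = F(d/dt)ψ` for a Gevrey bump `ψ`); NOT kernel-checked.
-/

noncomputable section

set_option linter.dupNamespace false

open Complex Filter Set MeasureTheory
open scoped Real Topology ComplexConjugate BigOperators ContDiff

namespace Summit.RiemannHypothesis.RiemannHypothesis.Theorems.PfPersistenceM2NegIndex

open Literature.NumberTheory.LFunctions
open Literature.NumberTheory.LFunctions.WeilConverse
open Literature.NumberTheory.LFunctions.ZetaZeros
open Summit.RiemannHypothesis.RiemannHypothesis.Theorems.RuelleBandExactFirstBand (weilMellin_one_sub_of_even)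
open Summit.RiemannHypothesis.RiemannHypothesis.Theorems.PfPersistenceParityIndex (im_deriv_eq_zero_of_real)
open Summit.RiemannHypothesis.RiemannHypothesis.Theorems.PolarPerronFrobenius (pt_deriv_deriv_even_of_even)

/-! ## N. The order of vanishing drops by one; induction; the equivalence -/

/-- `P_e` has a simple zero at `e`. [folklore] -/
theorem analyticOrderAt_quadPoly {e : ℂ} (he : 1 / 2 < e.re ∧ 0 < e.im) :
    analyticOrderAt (quadPoly e) e = 1 := by
  have hR : AnalyticAt ℂ (fun s : ℂ ↦ (s - conj e) * ((s - (1 - e)) * (s - (1 - conj e)))) e := by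
    fun_prop
  have hRe : (fun s : ℂ ↦ (s - conj e) * ((s - (1 - e)) * (s - (1 - conj e)))) e ≠ 0 := by
    have h := quadPoly_ne_zero he he
    -- use the three non-`(s - e)` factors directly
    refine mul_ne_zero ?_ (mul_ne_zero ?_ ?_) <;> intro h0 <;> rw [sub_eq_zero] at h0
    · have h1 := congrArg Complex.im h0; simp at h1; linarith [he.2]
    · have h1 := congrArg Complex.re h0; simp at h1; linarith [he.1]
    · have h1 := congrArg Complex.re h0; simp at h1; linarith [he.1]
  have hfac : quadPoly e = (fun s : ℂ ↦ s - e) * fun s : ℂ ↦ (s - conj e) * ((s - (1 - e)) * (s - (1 - conj e))) := by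
    funext s
    simp [quadPoly]
  have h1 : analyticOrderAt (fun s : ℂ ↦ s - e) e = 1 := by
    have h := analyticOrderAt_centeredMonomial (𝕜 := ℂ) (z₀ := e) (n := 1)
    simpa only [pow_one, Nat.cast_one] using h
  rw [hfac, analyticOrderAt_mul (by fun_prop) hR, h1, (hR.analyticOrderAt_eq_zero).2 hRe, add_zero]

/-- Induction on the order of vanishing at `e`: an even real test in `[-b, b]` with `f̂ ≢ 0` vanishing on
`Z ∖ {e}` (a set in the open quadrant) can be replaced by one with `ĝ(e) ≠ 0`, still vanishing on `Z ∖ {e}`.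
[folklore] -/
theorem exists_weilMellin_ne_zero_of_order_le {e : ℂ} (he : 1 / 2 < e.re ∧ 0 < e.im) {Z : Set ℂ}
    (hZ : ∀ ρ ∈ Z, 1 / 2 < ρ.re ∧ 0 < ρ.im) {b : ℝ} :
    ∀ (m : ℕ) (f : ℝ → ℂ), IsWeilTest f → (∀ t : ℝ, f (-t) = f t) → (∀ t : ℝ, (f t).im = 0) →
      tsupport f ⊆ Icc (-b) b → weilMellin f ≠ 0 → (∀ ρ ∈ Z, ρ ≠ e → weilMellin f ρ = 0) →
      analyticOrderAt (weilMellin f) e ≤ m →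
      ∃ g : ℝ → ℂ, IsWeilTest g ∧ (∀ t : ℝ, g (-t) = g t) ∧ (∀ t : ℝ, (g t).im = 0) ∧
        tsupport g ⊆ Icc (-b) b ∧ weilMellin g e ≠ 0 ∧ ∀ ρ ∈ Z, ρ ≠ e → weilMellin g ρ = 0 := by
  intro m
  induction m with
  | zero =>
    intro f hf hev hre hfs hne hvan hord
    have han : AnalyticAt ℂ (weilMellin f) e := analyticOnNhd_weilMellin hf.1.continuous hf.2 univ e trivial
    have h0 : analyticOrderAt (weilMellin f) e = 0 := nonpos_iff_eq_zero.1 (by exact_mod_cast hord)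
    exact ⟨f, hf, hev, hre, hfs, han.analyticOrderAt_eq_zero.1 h0, hvan⟩
  | succ m ih =>
    intro f hf hev hre hfs hne hvan hord
    by_cases hfe : weilMellin f e ≠ 0
    · exact ⟨f, hf, hev, hre, hfs, hfe, hvan⟩
    rw [not_ne_iff] at hfe
    obtain ⟨h, hh, hhev, hhre, hhs, hhm⟩ := exists_evenReal_divide_quad hf hev hre hfs he hfe
    have hPh : weilMellin f = quadPoly e * weilMellin h := funext fun s ↦ by simpa using hhm s
    have hhne : weilMellin h ≠ 0 := fun h0 ↦ hne (by rw [hPh, h0, mul_zero])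
    have hanh : ∀ z : ℂ, AnalyticAt ℂ (weilMellin h) z := fun z ↦
      analyticOnNhd_weilMellin hh.1.continuous hh.2 univ z trivial
    have hanP : AnalyticAt ℂ (quadPoly e) e := by unfold quadPoly; fun_prop
    have htop : analyticOrderAt (weilMellin h) e ≠ ⊤ := by
      rw [ne_eq, AnalyticOnNhd.analyticOrderAt_eq_top_iff_eq_zero e hanh]
      exact hhne
    obtain ⟨k, hk⟩ := ENat.ne_top_iff_exists.1 htop
    have hmul : analyticOrderAt (weilMellin f) e = 1 + analyticOrderAt (weilMellin h) e := by
      rw [hPh, analyticOrderAt_mul hanP (hanh e), analyticOrderAt_quadPoly he]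
    have hkm : k ≤ m := by
      rw [hmul, ← hk] at hord
      have h1 : ((1 + k : ℕ) : ℕ∞) ≤ ((m + 1 : ℕ) : ℕ∞) := by push_cast; exact hord
      have h2 := ENat.coe_le_coe.1 h1
      omega
    have hvanh : ∀ ρ ∈ Z, ρ ≠ e → weilMellin h ρ = 0 := fun ρ hρ hρe ↦ by
      have h1 := hhm ρ
      rw [hvan ρ hρ hρe] at h1
      exact (mul_eq_zero.1 h1.symm).resolve_left (quadPoly_ne_zero he (hZ ρ hρ) hρe)
    exact ih h hh hhev hhre hhs hhne hvanh (by rw [← hk]; exact_mod_cast hkm)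

/-- **(MULT_θ), the MULTIPLIER STATEMENT (HYPOTHESIS, typed; PROVED for finite `𝒵_θ` via part 5; DERIVED in
general, NOT kernel-checked).**  If some non-trivial zero has `Re ρ ≥ 1/2 + θ`, `Im ρ > 0`, then ONE even,
real-valued Weil test `φ` supported in some `[-b, b]`, with transform `φ̂` not identically zero, has `φ̂(ρ) = 0`
at EVERY such zero.  Classical shape: `𝒵_θ` lies in the zero set of the Fourier–Laplace transform of a non-zero
smooth even real function of compact support. -/
@[conjecture] def QuadrantMultiplier (θ : ℝ) : Prop :=
  {ρ : ℂ | ρ ∈ riemannZetaNontrivialZeros ∧ 1 / 2 + θ ≤ ρ.re ∧ 0 < ρ.im}.Nonempty →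
    ∃ φ : ℝ → ℂ, ∃ b : ℝ, IsWeilTest φ ∧ (∀ t : ℝ, φ (-t) = φ t) ∧ (∀ t : ℝ, (φ t).im = 0) ∧
      tsupport φ ⊆ Icc (-b) b ∧ weilMellin φ ≠ 0 ∧
      ∀ ρ ∈ {ρ : ℂ | ρ ∈ riemannZetaNontrivialZeros ∧ 1 / 2 + θ ≤ ρ.re ∧ 0 < ρ.im}, weilMellin φ ρ = 0

/-- (MULT_θ) is monotone in `θ` (one multiplier serves every `θ' ≥ θ`). [folklore] -/
theorem QuadrantMultiplier.mono {θ θ' : ℝ} (hθ : θ ≤ θ') (hm : QuadrantMultiplier θ) :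
    QuadrantMultiplier θ' := by
  rintro ⟨e, he⟩
  obtain ⟨φ, b, hφ, hev, hre, hφs, hne, hvan⟩ := hm ⟨e, he.1, by linarith [he.2.1], he.2.2⟩
  exact ⟨φ, b, hφ, hev, hre, hφs, hne, fun ρ hρ ↦ hvan ρ ⟨hρ.1, by linarith [hρ.2.1], hρ.2.2⟩⟩

/-- **(MULT_θ) ⟹ (QA_θ)** (`θ > 0`): divide the zero at `e` out of the multiplier until the transform is non-zero
at `e` (finite order of vanishing, `f̂ ≢ 0` entire), keeping even/real/support and the zeros on `𝒵_θ ∖ {e}`;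
then the phase lemma of part 5. [folklore] -/
theorem quadrantAnnihilable_of_multiplier {θ : ℝ} (hθ : 0 < θ) (hm : QuadrantMultiplier θ) :
    QuadrantAnnihilable θ := by
  refine quadrantAnnihilable_of_ne_zero hθ fun e he ↦ ?_
  obtain ⟨φ, b, hφ, hev, hre, hφs, hne, hvan⟩ := hm ⟨e, he⟩
  have he' : 1 / 2 < e.re ∧ 0 < e.im := ⟨by linarith [he.2.1], he.2.2⟩
  have hZ : ∀ ρ ∈ {ρ : ℂ | ρ ∈ riemannZetaNontrivialZeros ∧ 1 / 2 + θ ≤ ρ.re ∧ 0 < ρ.im},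
      1 / 2 < ρ.re ∧ 0 < ρ.im := fun ρ hρ ↦ ⟨by linarith [hρ.2.1], hρ.2.2⟩
  have han : ∀ z : ℂ, AnalyticAt ℂ (weilMellin φ) z := fun z ↦
    analyticOnNhd_weilMellin hφ.1.continuous hφ.2 univ z trivial
  have htop : analyticOrderAt (weilMellin φ) e ≠ ⊤ := by
    rw [ne_eq, AnalyticOnNhd.analyticOrderAt_eq_top_iff_eq_zero e han]
    exact hne
  obtain ⟨k, hk⟩ := ENat.ne_top_iff_exists.1 htop
  obtain ⟨g, hg, hgev, hgre, hgs, hge, hgvan⟩ := exists_weilMellin_ne_zero_of_order_le he' hZ k φ hφ hev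
    hre hφs hne (fun ρ hρ _ ↦ hvan ρ hρ) (by rw [← hk])
  exact ⟨g, b, hg, hgev, hgre, hgs, hge, hgvan⟩

/-- **(QA_θ) ⟹ (MULT_θ)**: multiply the zero at `e` back in, `ψ = φ⁗ - (λ² + λ̄²) φ″ + λ²λ̄² φ` (`λ = e - ½`;
real coefficients) has `ψ̂ = P_e · φ̂`, which vanishes on all of `𝒵_θ` and is not identically zero
(order `1` at `e`). [folklore] -/
theorem quadrantMultiplier_of_annihilable {θ : ℝ} (hθ : 0 < θ) (hann : QuadrantAnnihilable θ) :
    QuadrantMultiplier θ := by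
  rintro ⟨e, he⟩
  obtain ⟨φ, b, hφ, hev, hre, hφs, hφe, hvan⟩ := hann e he
  have he' : 1 / 2 < e.re ∧ 0 < e.im := ⟨by linarith [he.2.1], he.2.2⟩
  set lam : ℂ := e - 1 / 2 with hlam
  set A : ℝ := 2 * (lam ^ 2).re with hA
  set B : ℝ := Complex.normSq (lam ^ 2) with hB
  have hAc : (A : ℂ) = lam ^ 2 + conj lam ^ 2 := by
    rw [hA, ← map_pow, Complex.add_conj]
  have hBc : (B : ℂ) = lam ^ 2 * conj lam ^ 2 := by
    rw [hB, ← map_pow, Complex.mul_conj]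
  have hcl : conj e - 1 / 2 = conj lam := by
    rw [hlam]
    apply Complex.ext <;> simp
  have hφ2 : IsWeilTest (deriv (deriv φ)) := hφ.deriv.deriv
  have hφ4 : IsWeilTest (deriv (deriv (deriv (deriv φ)))) := hφ2.deriv.deriv
  have hA2 : IsWeilTest fun t ↦ (-(A : ℂ)) * deriv (deriv φ) t := hφ2.const_mul _
  have hB0 : IsWeilTest fun t ↦ (B : ℂ) * φ t := hφ.const_mul _
  set ψ : ℝ → ℂ := deriv (deriv (deriv (deriv φ))) + ((fun t ↦ (-(A : ℂ)) * deriv (deriv φ) t) +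
    fun t ↦ (B : ℂ) * φ t) with hψdef
  have hψt : IsWeilTest ψ := hφ4.add (hA2.add hB0)
  have hψm : ∀ s : ℂ, weilMellin ψ s = quadPoly e s * weilMellin φ s := fun s ↦ by
    rw [hψdef, weilMellin_add hφ4.1.continuous hφ4.2 (hA2.add hB0).1.continuous (hA2.add hB0).2,
      weilMellin_add hA2.1.continuous hA2.2 hB0.1.continuous hB0.2, weilMellin_const_mul,
      weilMellin_const_mul, weilMellin_deriv_deriv hφ2, weilMellin_deriv_deriv hφ, quadPoly_eq, hAc, hBc, hcl]
    ring
  -- even, real, supported in `[-b, b]`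
  have hev2 : ∀ t : ℝ, deriv (deriv φ) (-t) = deriv (deriv φ) t := pt_deriv_deriv_even_of_even hev
  have hev4 : ∀ t : ℝ, deriv (deriv (deriv (deriv φ))) (-t) = deriv (deriv (deriv (deriv φ))) t :=
    pt_deriv_deriv_even_of_even hev2
  have hre1 : ∀ t : ℝ, (deriv φ t).im = 0 := im_deriv_eq_zero_of_real (hφ.1.differentiable (by simp)) hre
  have hre2 : ∀ t : ℝ, (deriv (deriv φ) t).im = 0 :=
    im_deriv_eq_zero_of_real (hφ.deriv.1.differentiable (by simp)) hre1
  have hre3 : ∀ t : ℝ, (deriv (deriv (deriv φ)) t).im = 0 :=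
    im_deriv_eq_zero_of_real (hφ2.1.differentiable (by simp)) hre2
  have hre4 : ∀ t : ℝ, (deriv (deriv (deriv (deriv φ))) t).im = 0 :=
    im_deriv_eq_zero_of_real (hφ2.deriv.1.differentiable (by simp)) hre3
  have hs2 : tsupport (deriv (deriv φ)) ⊆ Icc (-b) b :=
    tsupport_deriv_subset.trans (tsupport_deriv_subset.trans hφs)
  have hs4 : tsupport (deriv (deriv (deriv (deriv φ)))) ⊆ Icc (-b) b :=
    tsupport_deriv_subset.trans (tsupport_deriv_subset.trans hs2)
  have hψs : tsupport ψ ⊆ Icc (-b) b := by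
    refine (tsupport_add _ _).trans (union_subset hs4 ((tsupport_add _ _).trans (union_subset ?_ ?_)))
    · exact tsupport_mul_subset_right.trans hs2
    · exact tsupport_mul_subset_right.trans hφs
  -- `ψ̂ ≢ 0`: its order of vanishing at `e` is `1 + 0`
  have hanφ : ∀ z : ℂ, AnalyticAt ℂ (weilMellin φ) z := fun z ↦
    analyticOnNhd_weilMellin hφ.1.continuous hφ.2 univ z trivial
  have hanP : AnalyticAt ℂ (quadPoly e) e := by unfold quadPoly; fun_prop
  have hψfun : weilMellin ψ = quadPoly e * weilMellin φ := funext fun s ↦ by simpa using hψm s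
  have hord : analyticOrderAt (weilMellin ψ) e = 1 := by
    rw [hψfun, analyticOrderAt_mul hanP (hanφ e), analyticOrderAt_quadPoly he',
      ((hanφ e).analyticOrderAt_eq_zero).2 (by rw [hφe]; exact Complex.I_ne_zero), add_zero]
  have hψne : weilMellin ψ ≠ 0 := fun h0 ↦ by
    have h1 : analyticOrderAt (weilMellin ψ) e = ⊤ := analyticOrderAt_eq_top.2 (by simp [h0])
    rw [hord] at h1
    exact ENat.coe_ne_top 1 (by exact_mod_cast h1)
  refine ⟨ψ, b, hψt, fun t ↦ ?_, fun t ↦ ?_, hψs, hψne, fun ρ hρ ↦ ?_⟩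
  · simp only [hψdef, Pi.add_apply, hev4 t, hev2 t, hev t]
  · simp [hψdef, Complex.add_im, Complex.mul_im, hre4 t, hre2 t, hre t]
  · rw [hψm ρ]
    by_cases hρe : ρ = e
    · rw [hρe]
      simp [quadPoly]
    · rw [hvan ρ hρ hρe, mul_zero]

/-- **THE RESIDUE IDENTIFIED (RH-free).**  For `θ > 0`: (QA_θ) ⟺ (MULT_θ).  Hence everything parts 4–5 prove
"modulo (QA)" holds modulo the classical multiplier statement, and the hypothesis-free trichotomy of part 5 reads:
no window with `n + 1` independent negative even directions ⟹ `K ≤ n` OR for some `θ > 0` the set `𝒵_θ` is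
infinite and NO non-zero even real compactly supported test has transform vanishing on it. [folklore] -/
theorem quadrantAnnihilable_iff_multiplier {θ : ℝ} (hθ : 0 < θ) :
    QuadrantAnnihilable θ ↔ QuadrantMultiplier θ :=
  ⟨quadrantMultiplier_of_annihilable hθ, quadrantAnnihilable_of_multiplier hθ⟩

/-- The trichotomy of part 5 with the residue in multiplier form (RH-free, no hypothesis).
[cite: Bombieri2000Weil, Thm 9 (even part); Thm 11] -/
theorem encard_le_or_exists_not_multiplier (n : ℕ) (hno : ∀ a : ℝ, ¬ EvenNegIndexAtLeast (n + 1) a) :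
    {ρ : ℂ | ρ ∈ riemannZetaNontrivialZeros ∧ 1 / 2 < ρ.re ∧ 0 < ρ.im}.encard ≤ n ∨
      ∃ θ : ℝ, 0 < θ ∧ {ρ : ℂ | ρ ∈ riemannZetaNontrivialZeros ∧ 1 / 2 + θ ≤ ρ.re ∧ 0 < ρ.im}.Infinite ∧
        ¬ QuadrantMultiplier θ := by
  rcases encard_le_or_exists_not_annihilable n hno with hle | ⟨θ, hθ, hinf, hnot⟩
  · exact Or.inl hle
  · exact Or.inr ⟨θ, hθ, hinf, fun hm ↦ hnot (quadrantAnnihilable_of_multiplier hθ hm)⟩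

/-- Under (MULT) at every distance: `L_n^{ev} ↔ K ≤ n` for every `n` and every `K ∈ ℕ ∪ {∞}`.
[cite: Bombieri2000Weil, Thm 9 (even part)] -/
theorem forall_not_evenNegIndexAtLeast_succ_iff_of_multiplier
    (hm : ∀ θ : ℝ, 0 < θ → QuadrantMultiplier θ) (n : ℕ) :
    (∀ a : ℝ, ¬ EvenNegIndexAtLeast (n + 1) a) ↔
      {ρ : ℂ | ρ ∈ riemannZetaNontrivialZeros ∧ 1 / 2 < ρ.re ∧ 0 < ρ.im}.encard ≤ n :=
  forall_not_evenNegIndexAtLeast_succ_iff_of_annihilable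
    (fun θ hθ ↦ quadrantAnnihilable_of_multiplier hθ (hm θ hθ)) n

end Summit.RiemannHypothesis.RiemannHypothesis.Theorems.PfPersistenceM2NegIndex

end
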